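import Literature.MathematicalPhysics.KineticTheory.TaggedSphereSpectralGap
import Literature.MathematicalPhysics.KineticTheory.Hilbert6Wave0WeakFormProofs

/-!
# Flux-weighted second moments on the collision space (crux `SpectralContractionR`, stub D of line `Sketch`, 1/2)

Helper file for the core form bound `stub_coreBound` of the crux
`InformationPercolationEngine.SpectralContractionR` (stmt-AtomisticToContinuum-13913). On
`Ω = (ℝ³ × ℝ³) × S²` with the flux weight `ρ(v, w, ω) = ((v-w)·ω)₊ M(v) M(w)` (`M = maxwellianBeta 1`):
the weight is nonnegative, continuous, and invariant under the exchange `(v, w, ω) ↦ (w, v, -ω)` and under the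
collision involution `(v, w, ω) ↦ (w', v', ω)` (`(v', w') = collide ω (v, w)`; energy conservation for `M(v)M(w)`);
the four weighted second moments `∫ ρ g(v)²`, `∫ ρ g(w)²`, `∫ ρ g(v')²`, `∫ ρ g(w')²` all equal the energy
`N(g) = ∫ g² a₁ M` (bath marginal `∫∫ ((v-w)·ω)₊ M(w) = a₁(v)`, the Carleman representation
`lintegral_gain_eq_carleman` with detailed balance, and the exchange symmetry); and an AM–GM integrability lemma
for weighted pair products.
-/

noncomputable section

open MeasureTheory Metric Real Set Filter Topology
open scoped InnerProductSpace ENNReal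

namespace Summit.AtomisticToContinuum.HydrodynamicLimit.Theorems.SpectralContractionRLine.CoreBound

open Literature.MathematicalPhysics.KineticTheory
open Literature.Analysis.FunctionSpaces (maxwellianBeta maxwellianBeta_one maxwellianBeta_pos)
open Literature.Analysis.FluidPDE (globalMaxwellian)
open TaggedSphereDiffusion (collisionFrequency)

/-! ## The flux weight `ρ = ((v-w)·ω)₊ M(v) M(w)` and its symmetries -/

/-- `ρ ≥ 0`. [folklore] -/
theorem weight_nonneg (x : ((V3 × V3) × (sphere (0 : V3) 1))) :
    0 ≤ hardSphereKernel x.1 x.2 * (maxwellianBeta 1 x.1.1 * maxwellianBeta 1 x.1.2) :=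
  mul_nonneg (hardSphereKernel_nonneg _ _)
    (mul_nonneg (maxwellianBeta_pos one_pos _).le (maxwellianBeta_pos one_pos _).le)

/-- `ρ` is continuous. [folklore] -/
theorem continuous_weight :
    Continuous fun x : ((V3 × V3) × (sphere (0 : V3) 1)) => hardSphereKernel x.1 x.2 * (maxwellianBeta 1 x.1.1 * maxwellianBeta 1 x.1.2) := by
  refine continuous_hardSphereKernel.mul ?_
  exact ((continuous_maxwellianBeta 1).comp (continuous_fst.comp continuous_fst)).mul
    ((continuous_maxwellianBeta 1).comp (continuous_snd.comp continuous_fst))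

/-- `ρ` is measurable. [folklore] -/
theorem measurable_weight :
    Measurable fun x : ((V3 × V3) × (sphere (0 : V3) 1)) => hardSphereKernel x.1 x.2 * (maxwellianBeta 1 x.1.1 * maxwellianBeta 1 x.1.2) :=
  continuous_weight.measurable

/-- Conservation of `M(v) M(w)` in an elastic collision (energy conservation). [folklore] -/
theorem maxwellianBeta_mul_collide (ω : sphere (0 : V3) 1) (p : V3 × V3) :
    maxwellianBeta 1 (collide ω p).1 * maxwellianBeta 1 (collide ω p).2 =
      maxwellianBeta 1 p.1 * maxwellianBeta 1 p.2 := by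
  rw [maxwellianBeta_one]
  obtain ⟨a, c, b, hf⟩ := Literature.Analysis.FluidPDE.isMaxwellian_globalMaxwellian (E := V3)
  have hi := isCollisionInvariant_quadratic a c b ω p
  rw [hf, hf, hf, hf, ← Real.exp_add, ← Real.exp_add]
  simp only at hi
  exact congrArg Real.exp hi

/-- `ρ` is invariant under the exchange `(v, w, ω) ↦ (w, v, -ω)`. [folklore] -/
theorem weight_swapNeg (x : ((V3 × V3) × (sphere (0 : V3) 1))) :
    hardSphereKernel x.1.swap (-x.2) * (maxwellianBeta 1 x.1.2 * maxwellianBeta 1 x.1.1) =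
      hardSphereKernel x.1 x.2 * (maxwellianBeta 1 x.1.1 * maxwellianBeta 1 x.1.2) := by
  rw [hardSphereKernel_swap_neg]
  ring

/-- `ρ` is invariant under the collision involution `(v, w, ω) ↦ (w', v', ω)`. [folklore] -/
theorem weight_collideSwap (x : ((V3 × V3) × (sphere (0 : V3) 1))) :
    hardSphereKernel (collide x.2 x.1).swap x.2 *
        (maxwellianBeta 1 (collide x.2 x.1).2 * maxwellianBeta 1 (collide x.2 x.1).1) =
      hardSphereKernel x.1 x.2 * (maxwellianBeta 1 x.1.1 * maxwellianBeta 1 x.1.2) := by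
  rw [Literature.Analysis.FluidPDE.kernel_collideSwap hardSphereKernel_collide_neg hardSphereKernel_swap_neg,
    mul_comm (maxwellianBeta 1 (collide x.2 x.1).2), maxwellianBeta_mul_collide]

/-- Post-collisional velocities seen from the exchanged pair: `collide (-ω) (w, v) = (w', v')`. [folklore] -/
theorem collide_swapNeg (x : ((V3 × V3) × (sphere (0 : V3) 1))) :
    collide (-x.2) x.1.swap = (collide x.2 x.1).swap := by
  rw [Literature.Analysis.FluidPDE.collide_neg_dir, Literature.Analysis.FluidPDE.collide_swap]

/-! ## Integrability from finite weighted second moments -/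

/-- AM–GM integrability: if `w ≥ 0` and `∫ w F², ∫ w G² < ∞` then `w F G` is integrable. [folklore] -/
theorem integrable_weight_mul_mul {α : Type*} [MeasurableSpace α] {μ : Measure α} {w F G : α → ℝ}
    (hw : ∀ x, 0 ≤ w x) (hwm : Measurable w) (hFm : Measurable F) (hGm : Measurable G)
    (hF : ∫⁻ x, ENNReal.ofReal (w x * F x ^ 2) ∂μ < ∞) (hG : ∫⁻ x, ENNReal.ofReal (w x * G x ^ 2) ∂μ < ∞) :
    Integrable (fun x => w x * (F x * G x)) μ := by
  refine ⟨(hwm.mul (hFm.mul hGm)).aestronglyMeasurable, ?_⟩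
  have hbound : ∀ x, ‖w x * (F x * G x)‖ₑ ≤ ENNReal.ofReal (w x * F x ^ 2) + ENNReal.ofReal (w x * G x ^ 2) := by
    intro x
    rw [← ENNReal.ofReal_add (mul_nonneg (hw x) (sq_nonneg _)) (mul_nonneg (hw x) (sq_nonneg _)),
      Real.enorm_eq_ofReal_abs]
    refine ENNReal.ofReal_le_ofReal ?_
    rw [abs_mul, abs_of_nonneg (hw x), ← mul_add]
    refine mul_le_mul_of_nonneg_left ?_ (hw x)
    rw [abs_mul]
    nlinarith [sq_nonneg (|F x| - |G x|), sq_abs (F x), sq_abs (G x), abs_nonneg (F x), abs_nonneg (G x)]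
  calc ∫⁻ x, ‖w x * (F x * G x)‖ₑ ∂μ
      ≤ ∫⁻ x, (ENNReal.ofReal (w x * F x ^ 2) + ENNReal.ofReal (w x * G x ^ 2)) ∂μ := lintegral_mono hbound
    _ = (∫⁻ x, ENNReal.ofReal (w x * F x ^ 2) ∂μ) + ∫⁻ x, ENNReal.ofReal (w x * G x ^ 2) ∂μ :=
        lintegral_add_left ((hwm.mul (hFm.pow_const 2)).ennreal_ofReal) _
    _ < ∞ := ENNReal.add_lt_top.2 ⟨hF, hG⟩


/-! ## Changes of variables on `Ω = (ℝ³ × ℝ³) × S²` -/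

/-- `lintegral` change of variables under the exchange `(v, w, ω) ↦ (w, v, -ω)`. [folklore] -/
theorem lintegral_comp_swapNeg (F : ((V3 × V3) × (sphere (0 : V3) 1)) → ℝ≥0∞) :
    ∫⁻ x, F (x.1.swap, -x.2) ∂(((volume : Measure V3).prod (volume : Measure V3)).prod (sphereMeasure : Measure (sphere (0 : V3) 1))) = ∫⁻ x, F x ∂(((volume : Measure V3).prod (volume : Measure V3)).prod (sphereMeasure : Measure (sphere (0 : V3) 1))) := by
  obtain ⟨e, he⟩ := Literature.Analysis.FluidPDE.exists_measurableEquiv_swapNegDir (E := V3)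
  have hfun : (fun x : ((V3 × V3) × (sphere (0 : V3) 1)) => (x.1.swap, -x.2)) = e := funext fun x => (he x).symm
  have hpres : MeasurePreserving e (((volume : Measure V3).prod (volume : Measure V3)).prod (sphereMeasure : Measure (sphere (0 : V3) 1))) (((volume : Measure V3).prod (volume : Measure V3)).prod (sphereMeasure : Measure (sphere (0 : V3) 1))) := by
    rw [← hfun]; exact Literature.Analysis.FluidPDE.measurePreserving_swap_negDir
  have h := hpres.lintegral_comp_emb e.measurableEmbedding F
  simpa only [he] using h

/-! ## Weighted second moments are the energy `N(g) = ∫ g² a₁ M` -/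

/-- `x ↦ (collide x.2 x.1).1` is measurable. [folklore] -/
theorem measurable_collide_fst : Measurable fun x : ((V3 × V3) × (sphere (0 : V3) 1)) => (collide x.2 x.1).1 :=
  continuous_collide_fst.measurable

/-- `x ↦ (collide x.2 x.1).2` is measurable. [folklore] -/
theorem measurable_collide_snd : Measurable fun x : ((V3 × V3) × (sphere (0 : V3) 1)) => (collide x.2 x.1).2 :=
  Literature.Analysis.FluidPDE.continuous_collide_uncurry.snd.measurable

/-- `x ↦ ((v-w)·ω)₊ M(w)` is measurable on `Ω`. [folklore] -/
theorem measurable_kernel_mul_maxwellian :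
    Measurable fun x : ((V3 × V3) × (sphere (0 : V3) 1)) => ENNReal.ofReal (hardSphereKernel x.1 x.2 * maxwellianBeta 1 x.1.2) :=
  (continuous_hardSphereKernel.mul ((continuous_maxwellianBeta 1).comp
    (continuous_snd.comp continuous_fst))).measurable.ennreal_ofReal

/-- The bath marginal: `∫∫ ((v-w)·ω)₊ M(w) dσ dw = a₁(v)` (as a `lintegral`). [folklore] -/
theorem lintegral_lintegral_kernel_mul_maxwellian (v : V3) :
    ∫⁻ w, ∫⁻ ω, ENNReal.ofReal (hardSphereKernel (v, w) ω * maxwellianBeta 1 w) ∂sphereMeasure =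
      ENNReal.ofReal (collisionFrequency 1 v) := by
  have h := lintegral_gain_eq_carleman (by simp) one_pos v (F := fun _ => 1) measurable_const
  simp only [mul_one] at h
  rw [h, lintegral_carlemanKernel (by simp) one_pos v]

/-- Tonelli on `Ω = (ℝ³ × ℝ³) × S²`: a triple `lintegral` as an iterated one. [folklore] -/
theorem lintegral_prod3 (F : ((V3 × V3) × (sphere (0 : V3) 1)) → ℝ≥0∞) (hF : Measurable F) :
    ∫⁻ x, F x ∂(((volume : Measure V3).prod (volume : Measure V3)).prod (sphereMeasure : Measure (sphere (0 : V3) 1))) = ∫⁻ v, ∫⁻ w, ∫⁻ ω, F ((v, w), ω) ∂sphereMeasure := by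
  rw [lintegral_prod _ hF.aemeasurable, lintegral_prod _ hF.lintegral_prod_right'.aemeasurable]

/-- **`E[g(v)²] = N(g)`**: `∫ ρ g(v)² dλ = ∫ g² a₁ M`. [folklore] -/
theorem lintegral_weight_mul_sq_fst {g : V3 → ℝ} (hg : Measurable g) :
    ∫⁻ x, ENNReal.ofReal (hardSphereKernel x.1 x.2 * (maxwellianBeta 1 x.1.1 * maxwellianBeta 1 x.1.2) *
        g x.1.1 ^ 2) ∂(((volume : Measure V3).prod (volume : Measure V3)).prod (sphereMeasure : Measure (sphere (0 : V3) 1))) =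
      ∫⁻ v, ENNReal.ofReal (g v ^ 2 * collisionFrequency 1 v * maxwellianBeta 1 v) := by
  have hpt : ∀ x : ((V3 × V3) × (sphere (0 : V3) 1)), ENNReal.ofReal (hardSphereKernel x.1 x.2 *
      (maxwellianBeta 1 x.1.1 * maxwellianBeta 1 x.1.2) * g x.1.1 ^ 2) =
      ENNReal.ofReal (g x.1.1 ^ 2 * maxwellianBeta 1 x.1.1) *
        ENNReal.ofReal (hardSphereKernel x.1 x.2 * maxwellianBeta 1 x.1.2) := by
    intro x
    rw [← ENNReal.ofReal_mul (mul_nonneg (sq_nonneg _) (maxwellianBeta_pos one_pos _).le)]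
    congr 1; ring
  simp_rw [hpt]
  have hm1 : Measurable fun x : ((V3 × V3) × (sphere (0 : V3) 1)) => ENNReal.ofReal (g x.1.1 ^ 2 * maxwellianBeta 1 x.1.1) :=
    (((hg.comp (measurable_fst.comp measurable_fst)).pow_const 2).mul
      ((continuous_maxwellianBeta 1).measurable.comp (measurable_fst.comp measurable_fst))).ennreal_ofReal
  rw [lintegral_prod3 (fun x : ((V3 × V3) × (sphere (0 : V3) 1)) => ENNReal.ofReal (g x.1.1 ^ 2 * maxwellianBeta 1 x.1.1) *
      ENNReal.ofReal (hardSphereKernel x.1 x.2 * maxwellianBeta 1 x.1.2))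
    (hm1.mul measurable_kernel_mul_maxwellian)]
  refine lintegral_congr fun v => ?_
  simp only
  have hin : ∀ w : V3, ∫⁻ ω, ENNReal.ofReal (g v ^ 2 * maxwellianBeta 1 v) *
      ENNReal.ofReal (hardSphereKernel (v, w) ω * maxwellianBeta 1 w) ∂sphereMeasure =
      ENNReal.ofReal (g v ^ 2 * maxwellianBeta 1 v) *
        ∫⁻ ω, ENNReal.ofReal (hardSphereKernel (v, w) ω * maxwellianBeta 1 w) ∂sphereMeasure :=
    fun w => lintegral_const_mul' _ _ ENNReal.ofReal_ne_top
  simp_rw [hin]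
  rw [lintegral_const_mul' _ _ ENNReal.ofReal_ne_top, lintegral_lintegral_kernel_mul_maxwellian v,
    ← ENNReal.ofReal_mul (mul_nonneg (sq_nonneg _) (maxwellianBeta_pos one_pos _).le)]
  congr 1; ring

/-- **`E[g(v')²] = N(g)`** (Carleman representation + detailed balance): `∫ ρ g(v')² dλ = ∫ g² a₁ M`. [folklore] -/
theorem lintegral_weight_mul_sq_collide_fst {g : V3 → ℝ} (hg : Measurable g) :
    ∫⁻ x, ENNReal.ofReal (hardSphereKernel x.1 x.2 * (maxwellianBeta 1 x.1.1 * maxwellianBeta 1 x.1.2) *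
        g (collide x.2 x.1).1 ^ 2) ∂(((volume : Measure V3).prod (volume : Measure V3)).prod (sphereMeasure : Measure (sphere (0 : V3) 1))) =
      ∫⁻ v, ENNReal.ofReal (g v ^ 2 * collisionFrequency 1 v * maxwellianBeta 1 v) := by
  set G : V3 → ℝ≥0∞ := fun y => ENNReal.ofReal (g y ^ 2) with hGdef
  have hG : Measurable G := (hg.pow_const 2).ennreal_ofReal
  have hpt : ∀ x : ((V3 × V3) × (sphere (0 : V3) 1)), ENNReal.ofReal (hardSphereKernel x.1 x.2 *
      (maxwellianBeta 1 x.1.1 * maxwellianBeta 1 x.1.2) * g (collide x.2 x.1).1 ^ 2) =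
      ENNReal.ofReal (maxwellianBeta 1 x.1.1) *
        (ENNReal.ofReal (hardSphereKernel x.1 x.2 * maxwellianBeta 1 x.1.2) * G (collide x.2 x.1).1) := by
    intro x
    rw [hGdef, ← ENNReal.ofReal_mul (mul_nonneg (hardSphereKernel_nonneg _ _) (maxwellianBeta_pos one_pos _).le),
      ← ENNReal.ofReal_mul (maxwellianBeta_pos one_pos _).le]
    congr 1; ring
  simp_rw [hpt]
  have hm1 : Measurable fun x : ((V3 × V3) × (sphere (0 : V3) 1)) => ENNReal.ofReal (maxwellianBeta 1 x.1.1) :=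
    ((continuous_maxwellianBeta 1).measurable.comp (measurable_fst.comp measurable_fst)).ennreal_ofReal
  rw [lintegral_prod3 (fun x : ((V3 × V3) × (sphere (0 : V3) 1)) => ENNReal.ofReal (maxwellianBeta 1 x.1.1) *
      (ENNReal.ofReal (hardSphereKernel x.1 x.2 * maxwellianBeta 1 x.1.2) * G (collide x.2 x.1).1))
    (hm1.mul (measurable_kernel_mul_maxwellian.mul (hG.comp measurable_collide_fst)))]
  have hin : ∀ v : V3, ∫⁻ w, ∫⁻ ω, ENNReal.ofReal (maxwellianBeta 1 ((v, w), ω).1.1) *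
      (ENNReal.ofReal (hardSphereKernel ((v, w), ω).1 ((v, w), ω).2 * maxwellianBeta 1 ((v, w), ω).1.2) *
        G (collide ((v, w), ω).2 ((v, w), ω).1).1) ∂sphereMeasure =
      ENNReal.ofReal (maxwellianBeta 1 v) * ∫⁻ u, ENNReal.ofReal (carlemanKernel 1 v u) * G (v + u) := by
    intro v
    simp only
    simp_rw [lintegral_const_mul' _ _ ENNReal.ofReal_ne_top]
    rw [lintegral_gain_eq_carleman (by simp) one_pos v hG]
  simp_rw [hin]
  have hin2 : ∀ v : V3, ENNReal.ofReal (maxwellianBeta 1 v) * ∫⁻ u, ENNReal.ofReal (carlemanKernel 1 v u) * G (v + u) =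
      ∫⁻ u, ENNReal.ofReal (maxwellianBeta 1 v * carlemanKernel 1 v u) * G (v + u) := by
    intro v
    rw [← lintegral_const_mul' _ _ ENNReal.ofReal_ne_top]
    refine lintegral_congr fun u => ?_
    rw [ENNReal.ofReal_mul (maxwellianBeta_pos one_pos _).le, mul_assoc]
  simp_rw [hin2]
  rw [lintegral_lintegral_maxwellianBeta_mul_carlemanKernel_right (by simp) one_pos hG]
  refine lintegral_congr fun v => ?_
  rw [hGdef, ← ENNReal.ofReal_mul (mul_nonneg (TaggedLinearBoltzmannSeries.collisionFrequency_nonneg one_pos v)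
    (maxwellianBeta_pos one_pos _).le)]
  congr 1; ring

/-- **`E[g(w)²] = N(g)`** (exchange symmetry). [folklore] -/
theorem lintegral_weight_mul_sq_snd {g : V3 → ℝ} (hg : Measurable g) :
    ∫⁻ x, ENNReal.ofReal (hardSphereKernel x.1 x.2 * (maxwellianBeta 1 x.1.1 * maxwellianBeta 1 x.1.2) *
        g x.1.2 ^ 2) ∂(((volume : Measure V3).prod (volume : Measure V3)).prod (sphereMeasure : Measure (sphere (0 : V3) 1))) =
      ∫⁻ v, ENNReal.ofReal (g v ^ 2 * collisionFrequency 1 v * maxwellianBeta 1 v) := by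
  rw [← lintegral_weight_mul_sq_fst hg, ← lintegral_comp_swapNeg (fun x : ((V3 × V3) × (sphere (0 : V3) 1)) => ENNReal.ofReal
    (hardSphereKernel x.1 x.2 * (maxwellianBeta 1 x.1.1 * maxwellianBeta 1 x.1.2) * g x.1.1 ^ 2))]
  refine lintegral_congr fun x => ?_
  simp only [Prod.fst_swap, Prod.snd_swap]
  rw [← weight_swapNeg x]

/-- **`E[g(w')²] = N(g)`** (exchange symmetry of `E[g(v')²]`). [folklore] -/
theorem lintegral_weight_mul_sq_collide_snd {g : V3 → ℝ} (hg : Measurable g) :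
    ∫⁻ x, ENNReal.ofReal (hardSphereKernel x.1 x.2 * (maxwellianBeta 1 x.1.1 * maxwellianBeta 1 x.1.2) *
        g (collide x.2 x.1).2 ^ 2) ∂(((volume : Measure V3).prod (volume : Measure V3)).prod (sphereMeasure : Measure (sphere (0 : V3) 1))) =
      ∫⁻ v, ENNReal.ofReal (g v ^ 2 * collisionFrequency 1 v * maxwellianBeta 1 v) := by
  rw [← lintegral_weight_mul_sq_collide_fst hg, ← lintegral_comp_swapNeg (fun x : ((V3 × V3) × (sphere (0 : V3) 1)) => ENNReal.ofReal
    (hardSphereKernel x.1 x.2 * (maxwellianBeta 1 x.1.1 * maxwellianBeta 1 x.1.2) * g (collide x.2 x.1).1 ^ 2))]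
  refine lintegral_congr fun x => ?_
  simp only [collide_swapNeg, Prod.fst_swap, Prod.snd_swap]
  rw [← weight_swapNeg x]

/-! ## Summary (registered sub-goal of the crux skeleton) -/

/-- **SUB-GOAL `stub_weightedMoments` of line `Sketch` (registered on the crux item; feeds `stub_coreBound`).**
The four flux-weighted second moments `∫ ρ g(v)²`, `∫ ρ g(w)²`, `∫ ρ g(v')²`, `∫ ρ g(w')²` on
`Ω = (ℝ³ × ℝ³) × S²` all equal the energy `∫ g² a₁ M`. [folklore] -/
theorem stub_weightedMoments : ∀ g : V3 → ℝ, Measurable g →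
    (∫⁻ x, ENNReal.ofReal (hardSphereKernel x.1 x.2 * (maxwellianBeta 1 x.1.1 * maxwellianBeta 1 x.1.2) * g x.1.1 ^ 2) ∂(((volume : Measure V3).prod (volume : Measure V3)).prod (sphereMeasure : Measure (sphere (0 : V3) 1))) = ∫⁻ v, ENNReal.ofReal (g v ^ 2 * collisionFrequency 1 v * maxwellianBeta 1 v)) ∧
    (∫⁻ x, ENNReal.ofReal (hardSphereKernel x.1 x.2 * (maxwellianBeta 1 x.1.1 * maxwellianBeta 1 x.1.2) * g x.1.2 ^ 2) ∂(((volume : Measure V3).prod (volume : Measure V3)).prod (sphereMeasure : Measure (sphere (0 : V3) 1))) = ∫⁻ v, ENNReal.ofReal (g v ^ 2 * collisionFrequency 1 v * maxwellianBeta 1 v)) ∧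
    (∫⁻ x, ENNReal.ofReal (hardSphereKernel x.1 x.2 * (maxwellianBeta 1 x.1.1 * maxwellianBeta 1 x.1.2) * g (collide x.2 x.1).1 ^ 2) ∂(((volume : Measure V3).prod (volume : Measure V3)).prod (sphereMeasure : Measure (sphere (0 : V3) 1))) = ∫⁻ v, ENNReal.ofReal (g v ^ 2 * collisionFrequency 1 v * maxwellianBeta 1 v)) ∧
    (∫⁻ x, ENNReal.ofReal (hardSphereKernel x.1 x.2 * (maxwellianBeta 1 x.1.1 * maxwellianBeta 1 x.1.2) * g (collide x.2 x.1).2 ^ 2) ∂(((volume : Measure V3).prod (volume : Measure V3)).prod (sphereMeasure : Measure (sphere (0 : V3) 1))) = ∫⁻ v, ENNReal.ofReal (g v ^ 2 * collisionFrequency 1 v * maxwellianBeta 1 v)) :=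
  fun _ hg => ⟨lintegral_weight_mul_sq_fst hg, lintegral_weight_mul_sq_snd hg, lintegral_weight_mul_sq_collide_fst hg,
    lintegral_weight_mul_sq_collide_snd hg⟩

end Summit.AtomisticToContinuum.HydrodynamicLimit.Theorems.SpectralContractionRLine.CoreBound

end
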